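import Summits.CriticalPhenomena.PercolationContinuityZ3.Theorems.PercNearOneGluingNoHeavyLowerTailSahiCoSunflowerSeparated
import Summits.CriticalPhenomena.PercolationContinuityZ3.Theorems.PercNearOneGluingNoHeavyLowerTailSahiStrongCubicPlus
import Mathlib.Tactic.Linarith
import Mathlib.Tactic.Ring
import Mathlib.Tactic.Positivity
import HarnessLib

/-!
# `NoHeavyLowerTail` (crux stmt-CriticalPhenomena-4575), master-family line P1 (gen 16):
# THEOREM — the ONE-PAYER inequality `e₃ ≤ max(κ,o)·(κo − e₂)` (S₃^max), hence S₃⁺, on every co-sunflower with PAIRWISE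
# SEPARATED generators (`G_i ∩ G_j = {univ}`) — the dual stratum of the atom-covering one, where the CORE pays exactly

Support file (seat `prim-masterthm-p1`, gen 16; `--supports stmt-CriticalPhenomena-4575`).  Pure proof file, no `sorry`,
standard axioms.  Memo `run/shared/lean/prim/prim-masterthm/FROM-prim-masterthm-p1-g16-ONE-PAYER.md` §6(3); sibling file
`…SahiStrongCubicMaxAtomCovering` (outside pays exactly at the envelope).

SETTING (tree `SahiDeepCore`): cells `α, β, d` (petals), `κ` (core), `o` (outside) of the sandwiched co-sunflower
`(G₂∪G₃, G₁∪G₃, G₁∪G₂)`; `G = κo − e₂`; S₃^max: `max(κ,o)·G ≥ e₃` (typed `StrongCubicMaxNonneg` in `…SahiStrongCubicMax`).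
Gen 13 (`…SahiCoSunflowerSeparated`) proved S₃ on the SEPARATED stratum — `univ ∈ G₁, G₂` and no co-atom `{u}ᶜ` in two of the
`G_i` — by transfer INTO THE OUTSIDE at fixed core mass towards the envelope "petal `i` ⊆ all coordinates of the other two
co-atom groups present, `S ≠ univ`" (the AND-block composite of the dual standard system).

NEW HERE (all [this work]):
1. `maxCells_antitone_core` — transfer principle for the max-side functional at FIXED CORE mass `k ≥ 0` (`o = 1−k−α−β−d`
   shrinks as petals grow; needs `G ≥ 0` at the lighter point).
2. **THEOREM `coSunflower_maxSide_nonneg_of_separated`**: on the separated stratum `max(κ,o)·(κo − e₂) − e₃ ≥ 0`.  At the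
   envelope (core `k = abc`, petals `ac−k, bc−k, ab−k`, `a,b,c` the co-atom group products of `p_u`) **the core pays EXACTLY**:
   `e₃ = κ·G` with `G = k(1−a)(1−b)(1−c)` (`ring`), so the value there is `(max(κ,o) − κ)·G ≥ 0`.
3. COROLLARY `coSunflower_strongCubicPlus_nonneg_of_separated` (S₃⁺ on the stratum; gen 13 had S₃ and the class law).
Together with the atom-covering file: the one-payer conjecture is a theorem on both "pure payment" strata, with the payer
predicted by the memo (outside for atom-covering / std3-like, core for separated / dual-like).
-/

noncomputable section

open scoped Classical

namespace Summit.CriticalPhenomena.PercolationContinuityZ3.Theorems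

namespace SahiDeepCore

open Finset
open Literature.Combinatorics.Sahi2008
open Literature.Probability.LatticeModels (prodBernoulli)
open Literature.Probability.Percolation.DecisionTree (ind ind_of_mem ind_of_not_mem ind_nonneg)

variable {ι : Type} [Fintype ι]

local notation3 (prettyPrint := false) "m⟦" p ", " X "⟧" => ex (bernoulliWeight p) (ind X)

/-! ### 1. Transfer principle at fixed core mass -/

/-- **Transfer principle for the max-side functional at fixed core mass** (pure real-variable statement).  With
`o = 1−k−x−y−z`, `G = k·o − (xy+xz+yz)`: if `0 ≤ k`, `0 ≤ x ≤ x'`, `0 ≤ y ≤ y'`, `0 ≤ z ≤ z'` and `0 ≤ G(x,y,z)`, then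
`max(k,o')·G(x',y',z') − x'y'z' ≤ max(k,o)·G(x,y,z) − xyz`. [this work] -/
theorem maxCells_antitone_core {k x y z x' y' z' : ℝ} (hk : 0 ≤ k) (hx : 0 ≤ x) (hy : 0 ≤ y) (hz : 0 ≤ z)
    (hxx : x ≤ x') (hyy : y ≤ y') (hzz : z ≤ z')
    (hG : 0 ≤ k * (1 - k - x - y - z) - (x * y + x * z + y * z)) :
    max k (1 - k - x' - y' - z') * (k * (1 - k - x' - y' - z') - (x' * y' + x' * z' + y' * z')) - x' * y' * z'
      ≤ max k (1 - k - x - y - z) * (k * (1 - k - x - y - z) - (x * y + x * z + y * z)) - x * y * z := by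
  set G := k * (1 - k - x - y - z) - (x * y + x * z + y * z) with hGdef
  set G' := k * (1 - k - x' - y' - z') - (x' * y' + x' * z' + y' * z') with hG'def
  have hx' : 0 ≤ x' := le_trans hx hxx
  have hy' : 0 ≤ y' := le_trans hy hyy
  have hz' : 0 ≤ z' := le_trans hz hzz
  have hGG : G' ≤ G := by
    have : G - G' = k * (x' - x + (y' - y) + (z' - z))
        + (x' * y' - x * y) + (x' * z' - x * z) + (y' * z' - y * z) := by
      simp only [hGdef, hG'def]; ring
    have h1 : x * y ≤ x' * y' := mul_le_mul hxx hyy hy hx'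
    have h2 : x * z ≤ x' * z' := mul_le_mul hxx hzz hz hx'
    have h3 : y * z ≤ y' * z' := mul_le_mul hyy hzz hz hy'
    nlinarith
  have he : x * y * z ≤ x' * y' * z' :=
    mul_le_mul (mul_le_mul hxx hyy hy hx') hzz hz (mul_nonneg hx' hy')
  have hmax : max k (1 - k - x' - y' - z') ≤ max k (1 - k - x - y - z) :=
    max_le_max le_rfl (by linarith)
  have hmax0 : 0 ≤ max k (1 - k - x' - y' - z') := le_trans hk (le_max_left _ _)
  have step1 : max k (1 - k - x' - y' - z') * G' ≤ max k (1 - k - x' - y' - z') * G :=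
    mul_le_mul_of_nonneg_left hGG hmax0
  have step2 : max k (1 - k - x' - y' - z') * G ≤ max k (1 - k - x - y - z) * G :=
    mul_le_mul_of_nonneg_right hmax hG
  linarith

/-! ### 2. Plumbing (local copies) -/

/-- `0 ≤ μ_p(X)`. [folklore] -/
private theorem massSep_nonneg (p : ι → unitInterval) (X : Set (Set ι)) : 0 ≤ m⟦p, X⟧ :=
  ex_nonneg (isFKGMeasure_bernoulliWeight p).nonneg fun ω => ind_nonneg _ ω

/-- `μ_p(Y ∖ X) = μ_p(Y) − μ_p(X)` for `X ⊆ Y`. [folklore] -/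
private theorem massSep_sdiff (p : ι → unitInterval) {X Y : Set (Set ι)} (h : X ⊆ Y) :
    m⟦p, Y \ X⟧ = m⟦p, Y⟧ - m⟦p, X⟧ := by
  have e : ind Y = ind X + ind (Y \ X) := by
    funext ω
    simp only [Pi.add_apply]
    by_cases hx : ω ∈ X
    · rw [ind_of_mem (h hx), ind_of_mem hx, ind_of_not_mem (fun hh : ω ∈ Y \ X => hh.2 hx), add_zero]
    · by_cases hy : ω ∈ Y
      · rw [ind_of_mem hy, ind_of_not_mem hx, ind_of_mem (show ω ∈ Y \ X from ⟨hy, hx⟩), zero_add]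
      · rw [ind_of_not_mem hy, ind_of_not_mem hx, ind_of_not_mem (fun hh : ω ∈ Y \ X => hy hh.1), add_zero]
  have := congrArg (ex (bernoulliWeight p)) e
  rw [ex_add] at this
  linarith

/-- Monotonicity of `μ_p`. [folklore] -/
private theorem massSep_mono (p : ι → unitInterval) {X Y : Set (Set ι)} (h : X ⊆ Y) : m⟦p, X⟧ ≤ m⟦p, Y⟧ := by
  have := massSep_sdiff p h
  have h0 := massSep_nonneg p (Y \ X)
  linarith

/-! ### 3. The one-payer inequality on the separated stratum -/

/-- **THEOREM (S₃^max for pairwise separated generators).**  Let `G₁,G₂,G₃` be increasing events of the finite cube with a product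
weight, `univ ∈ G₁, G₂`, and no co-atom `{u}ᶜ` in two of them.  Then for the cells of the co-sunflower `(G₂∪G₃, G₁∪G₃, G₁∪G₂)`:
`max(κ, o)·(κ·o − (αβ+αd+βd)) − αβd ≥ 0` — the heavier of core and outside pays for all rainbows (at the envelope the core pays
exactly). [this work] -/
theorem coSunflower_maxSide_nonneg_of_separated (p : ι → unitInterval) {G₁ G₂ G₃ : Set (Set ι)} (h₁ : IsUpperSet G₁)
    (h₂ : IsUpperSet G₂) (h₃ : IsUpperSet G₃) (hu₁ : Set.univ ∈ G₁) (hu₂ : Set.univ ∈ G₂)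
    (hsep : ∀ u : ι, ¬(({u}ᶜ : Set ι) ∈ G₁ ∧ ({u}ᶜ : Set ι) ∈ G₂) ∧ ¬(({u}ᶜ : Set ι) ∈ G₁ ∧ ({u}ᶜ : Set ι) ∈ G₃) ∧
      ¬(({u}ᶜ : Set ι) ∈ G₂ ∧ ({u}ᶜ : Set ι) ∈ G₃)) :
    0 ≤ max (m⟦p, (G₂ ∪ G₃) ∩ (G₁ ∪ G₃) ∩ (G₁ ∪ G₂)⟧) (m⟦p, ((G₂ ∪ G₃) ∪ (G₁ ∪ G₃))ᶜ⟧) *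
          (m⟦p, (G₂ ∪ G₃) ∩ (G₁ ∪ G₃) ∩ (G₁ ∪ G₂)⟧ * m⟦p, ((G₂ ∪ G₃) ∪ (G₁ ∪ G₃))ᶜ⟧
            - (m⟦p, (G₂ ∪ G₃) \ (G₁ ∪ G₃)⟧ * m⟦p, (G₁ ∪ G₃) \ (G₂ ∪ G₃)⟧
                + m⟦p, (G₂ ∪ G₃) \ (G₁ ∪ G₃)⟧ * m⟦p, ((G₂ ∪ G₃) ∩ (G₁ ∪ G₃)) \ (G₁ ∪ G₂)⟧
                + m⟦p, (G₁ ∪ G₃) \ (G₂ ∪ G₃)⟧ * m⟦p, ((G₂ ∪ G₃) ∩ (G₁ ∪ G₃)) \ (G₁ ∪ G₂)⟧))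
        - m⟦p, (G₂ ∪ G₃) \ (G₁ ∪ G₃)⟧ * m⟦p, (G₁ ∪ G₃) \ (G₂ ∪ G₃)⟧ * m⟦p, ((G₂ ∪ G₃) ∩ (G₁ ∪ G₃)) \ (G₁ ∪ G₂)⟧ := by
  obtain ⟨s1, s2, s3⟩ := coSunflower_sandwich G₁ G₂ G₃
  obtain ⟨e3, e2, e1⟩ := coSunflower_privateParts G₁ G₂ G₃
  obtain ⟨dAB, dAC, dBC, hcover⟩ := cgrp_disjoint_cover G₂ G₃
  have hm := mem_cgrp G₂ G₃
  set PA := cgrpA G₂ G₃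
  set PB := cgrpB G₂
  set PC := cgrpC G₂ G₃
  set a := ∏ u ∈ PA, (p u : ℝ)
  set b := ∏ u ∈ PB, (p u : ℝ)
  set c := ∏ u ∈ PC, (p u : ℝ)
  -- the core is {univ}
  have hcore : (G₂ ∪ G₃) ∩ (G₁ ∪ G₃) ∩ (G₁ ∪ G₂) = contain (Finset.univ : Finset ι) := by
    rw [contain_univ_eq]
    ext S
    simp only [Set.mem_inter_iff, Set.mem_union, Set.mem_singleton_iff]
    constructor
    · rintro ⟨⟨h23, h13⟩, h12⟩
      by_contra hne
      obtain ⟨u, hu⟩ : ∃ u, u ∉ S := by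
        by_contra hall
        exact hne (Set.eq_univ_iff_forall.2 fun u => by_contra fun hu => hall ⟨u, hu⟩)
      have two : (S ∈ G₁ ∧ S ∈ G₂) ∨ (S ∈ G₁ ∧ S ∈ G₃) ∨ (S ∈ G₂ ∧ S ∈ G₃) := by tauto
      rcases two with ⟨a1, a2⟩ | ⟨a1, a3⟩ | ⟨a2, a3⟩
      · exact (hsep u).1 ⟨coatom_mem_of_notMem h₁ a1 hu, coatom_mem_of_notMem h₂ a2 hu⟩
      · exact (hsep u).2.1 ⟨coatom_mem_of_notMem h₁ a1 hu, coatom_mem_of_notMem h₃ a3 hu⟩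
      · exact (hsep u).2.2 ⟨coatom_mem_of_notMem h₂ a2 hu, coatom_mem_of_notMem h₃ a3 hu⟩
    · rintro rfl; exact ⟨⟨Or.inl hu₂, Or.inl hu₁⟩, Or.inl hu₁⟩
  have hprod_univ : ∏ u ∈ (Finset.univ : Finset ι), (p u : ℝ) = a * b * c := by
    rw [← hcover, Finset.prod_union (Finset.disjoint_union_left.2 ⟨dAC, dBC⟩), Finset.prod_union dAB]
  have hk : m⟦p, (G₂ ∪ G₃) ∩ (G₁ ∪ G₃) ∩ (G₁ ∪ G₂)⟧ = a * b * c := by rw [hcore, m_contain, hprod_univ]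
  have env_mass : ∀ R : Finset ι, m⟦p, contain R \ contain Finset.univ⟧ = (∏ u ∈ R, (p u : ℝ)) - a * b * c := by
    intro R; rw [massSep_sdiff p (contain_mono (Finset.subset_univ R)), m_contain, m_contain, hprod_univ]
  have pet1 : (G₂ ∪ G₃) \ (G₁ ∪ G₃) ⊆ contain (PA ∪ PC) \ contain Finset.univ := by
    rw [e2]
    intro S hS
    have hS2 : S ∈ G₂ := hS.1
    have hS1 : S ∉ G₁ := fun h => hS.2 (Or.inl h)
    refine ⟨?_, ?_⟩
    · intro u hu
      by_contra huS
      have c2 := coatom_mem_of_notMem h₂ hS2 huS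
      rcases Finset.mem_union.1 (Finset.mem_coe.1 hu) with h | h
      · exact ((hm u).1.1 h).1 c2
      · exact (hsep u).2.2 ⟨c2, ((hm u).2.2.1 h).1⟩
    · intro hS'
      rw [contain_univ_eq, Set.mem_singleton_iff] at hS'
      exact hS1 (hS' ▸ hu₁)
  have pet2 : (G₁ ∪ G₃) \ (G₂ ∪ G₃) ⊆ contain (PB ∪ PC) \ contain Finset.univ := by
    rw [e1]
    intro S hS
    have hS1 : S ∈ G₁ := hS.1
    have hS2 : S ∉ G₂ := fun h => hS.2 (Or.inl h)
    refine ⟨?_, ?_⟩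
    · intro u hu
      by_contra huS
      have c1 := coatom_mem_of_notMem h₁ hS1 huS
      rcases Finset.mem_union.1 (Finset.mem_coe.1 hu) with h | h
      · exact (hsep u).1 ⟨c1, (hm u).2.1.1 h⟩
      · exact (hsep u).2.1 ⟨c1, ((hm u).2.2.1 h).1⟩
    · intro hS'
      rw [contain_univ_eq, Set.mem_singleton_iff] at hS'
      exact hS2 (hS' ▸ hu₂)
  have pet3 : ((G₂ ∪ G₃) ∩ (G₁ ∪ G₃)) \ (G₁ ∪ G₂) ⊆ contain (PA ∪ PB) \ contain Finset.univ := by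
    rw [e3]
    intro S hS
    have hS3 : S ∈ G₃ := hS.1
    have hS1 : S ∉ G₁ := fun h => hS.2 (Or.inl h)
    refine ⟨?_, ?_⟩
    · intro u hu
      by_contra huS
      have c3 := coatom_mem_of_notMem h₃ hS3 huS
      rcases Finset.mem_union.1 (Finset.mem_coe.1 hu) with h | h
      · exact ((hm u).1.1 h).2 c3
      · exact (hsep u).2.2 ⟨(hm u).2.1.1 h, c3⟩
    · intro hS'
      rw [contain_univ_eq, Set.mem_singleton_iff] at hS'
      exact hS1 (hS' ▸ hu₁)
  have hα : m⟦p, (G₂ ∪ G₃) \ (G₁ ∪ G₃)⟧ ≤ a * c - a * b * c := by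
    refine le_trans (massSep_mono p pet1) ?_; rw [env_mass, Finset.prod_union dAC]
  have hβ : m⟦p, (G₁ ∪ G₃) \ (G₂ ∪ G₃)⟧ ≤ b * c - a * b * c := by
    refine le_trans (massSep_mono p pet2) ?_; rw [env_mass, Finset.prod_union dBC]
  have hd : m⟦p, ((G₂ ∪ G₃) ∩ (G₁ ∪ G₃)) \ (G₁ ∪ G₂)⟧ ≤ a * b - a * b * c := by
    refine le_trans (massSep_mono p pet3) ?_; rw [env_mass, Finset.prod_union dAB]
  -- outside mass eliminated; Gladkov at the actual point
  have hs := cells_sum_eq_one p (G₂ ∪ G₃) (G₁ ∪ G₃) (G₁ ∪ G₂)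
  have hG0 := gladkov_cells p (h₂.union h₃) (h₁.union h₃) (h₁.union h₂) s1 s2 s3
  have ho : m⟦p, ((G₂ ∪ G₃) ∪ (G₁ ∪ G₃))ᶜ⟧ = 1 - a * b * c - m⟦p, (G₂ ∪ G₃) \ (G₁ ∪ G₃)⟧ - m⟦p, (G₁ ∪ G₃) \ (G₂ ∪ G₃)⟧
      - m⟦p, ((G₂ ∪ G₃) ∩ (G₁ ∪ G₃)) \ (G₁ ∪ G₂)⟧ := by linarith
  rw [hk, ho]
  rw [hk, ho] at hG0
  set x := m⟦p, (G₂ ∪ G₃) \ (G₁ ∪ G₃)⟧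
  set y := m⟦p, (G₁ ∪ G₃) \ (G₂ ∪ G₃)⟧
  set z := m⟦p, ((G₂ ∪ G₃) ∩ (G₁ ∪ G₃)) \ (G₁ ∪ G₂)⟧
  have hx0 : 0 ≤ x := massSep_nonneg p _
  have hy0 : 0 ≤ y := massSep_nonneg p _
  have hz0 : 0 ≤ z := massSep_nonneg p _
  obtain ⟨ha0, ha1⟩ := prod_coe_mem p PA
  obtain ⟨hb0, hb1⟩ := prod_coe_mem p PB
  obtain ⟨hc0, hc1⟩ := prod_coe_mem p PC
  set k := a * b * c with hkdef
  have hk0 : 0 ≤ k := mul_nonneg (mul_nonneg ha0 hb0) hc0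
  have hG0' : 0 ≤ k * (1 - k - x - y - z) - (x * y + x * z + y * z) := by linarith
  -- transfer to the envelope (fixed core)
  have key := maxCells_antitone_core (k := k) hk0 hx0 hy0 hz0 hα hβ hd hG0'
  -- value at the envelope: the core pays exactly; value = (max(k,o'') − k)·G'' with G'' = k(1−a)(1−b)(1−c)
  have hGenv : k * (1 - k - (a * c - k) - (b * c - k) - (a * b - k))
        - ((a * c - k) * (b * c - k) + (a * c - k) * (a * b - k) + (b * c - k) * (a * b - k))
        = k * ((1 - a) * (1 - b) * (1 - c)) := by simp only [hkdef]; ring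
  have he3env : (a * c - k) * (b * c - k) * (a * b - k) = k * (k * ((1 - a) * (1 - b) * (1 - c))) := by
    simp only [hkdef]; ring
  have hGenv0 : 0 ≤ k * ((1 - a) * (1 - b) * (1 - c)) :=
    mul_nonneg hk0 (mul_nonneg (mul_nonneg (sub_nonneg.2 ha1) (sub_nonneg.2 hb1)) (sub_nonneg.2 hc1))
  have hval : 0 ≤ max k (1 - k - (a * c - k) - (b * c - k) - (a * b - k)) *
        (k * (1 - k - (a * c - k) - (b * c - k) - (a * b - k))
          - ((a * c - k) * (b * c - k) + (a * c - k) * (a * b - k) + (b * c - k) * (a * b - k)))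
        - (a * c - k) * (b * c - k) * (a * b - k) := by
    rw [hGenv, he3env]
    have hmk : k ≤ max k (1 - k - (a * c - k) - (b * c - k) - (a * b - k)) := le_max_left _ _
    nlinarith [mul_le_mul_of_nonneg_right hmk hGenv0]
  linarith

/-- **COROLLARY (S₃⁺ on the separated stratum).**  Under the same hypotheses `0 ≤ strongCubicPlus` for the co-sunflower. [this work] -/
theorem coSunflower_strongCubicPlus_nonneg_of_separated (p : ι → unitInterval) {G₁ G₂ G₃ : Set (Set ι)} (h₁ : IsUpperSet G₁)
    (h₂ : IsUpperSet G₂) (h₃ : IsUpperSet G₃) (hu₁ : Set.univ ∈ G₁) (hu₂ : Set.univ ∈ G₂)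
    (hsep : ∀ u : ι, ¬(({u}ᶜ : Set ι) ∈ G₁ ∧ ({u}ᶜ : Set ι) ∈ G₂) ∧ ¬(({u}ᶜ : Set ι) ∈ G₁ ∧ ({u}ᶜ : Set ι) ∈ G₃) ∧
      ¬(({u}ᶜ : Set ι) ∈ G₂ ∧ ({u}ᶜ : Set ι) ∈ G₃)) :
    0 ≤ strongCubicPlus p (G₂ ∪ G₃) (G₁ ∪ G₃) (G₁ ∪ G₂) := by
  have hmax := coSunflower_maxSide_nonneg_of_separated p h₁ h₂ h₃ hu₁ hu₂ hsep
  obtain ⟨s1, s2, s3⟩ := coSunflower_sandwich G₁ G₂ G₃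
  have hG := gladkov_cells p (h₂.union h₃) (h₁.union h₃) (h₁.union h₂) s1 s2 s3
  have hκ := massSep_nonneg p ((G₂ ∪ G₃) ∩ (G₁ ∪ G₃) ∩ (G₁ ∪ G₂))
  have ho := massSep_nonneg p ((G₂ ∪ G₃) ∪ (G₁ ∪ G₃))ᶜ
  have hle : max (m⟦p, (G₂ ∪ G₃) ∩ (G₁ ∪ G₃) ∩ (G₁ ∪ G₂)⟧) (m⟦p, ((G₂ ∪ G₃) ∪ (G₁ ∪ G₃))ᶜ⟧)
      ≤ m⟦p, (G₂ ∪ G₃) ∩ (G₁ ∪ G₃) ∩ (G₁ ∪ G₂)⟧ + m⟦p, ((G₂ ∪ G₃) ∪ (G₁ ∪ G₃))ᶜ⟧ :=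
    max_le (by linarith) (by linarith)
  have step := mul_le_mul_of_nonneg_right hle (sub_nonneg.2 hG)
  simp only [strongCubicPlus]
  linarith

end SahiDeepCore

end Summit.CriticalPhenomena.PercolationContinuityZ3.Theorems
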